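import Summits.SmoothPoincare4.SmoothPoincare4.Theses.RootDecompY
import Literature.Topology.FourManifolds.HomotopyS4CompactProofs
import Literature.Topology.FourManifolds.HomotopyS4OrientableProofs

/-! # RootDecompY — the split glue `CP2CancellationOneGscGlue` (item stmt-SmoothPoincare4-32281) PROVED.

`CP2CancellationOneGscGlue : NoOneHandlesExist → MorseGscIsRLinkSphere → GscCP2Cancellation → CP2CancellationOne`
(route Y rev 2, `--split CP2CancellationOne --into NoOneHandlesExist MorseGscIsRLinkSphere GscCP2Cancellation`).
Proof: a homotopy 4-sphere `M` is compact (`compactSpace_of_homotopyEquiv_sphere_four_holds`, Hatcher Prop. 3.29) and orientable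
(`isOrientable_of_homotopyEquiv_sphere_four_holds`), hence packages as a `HomotopySphere 4`; `NoOneHandlesExist` gives a Morse function
without index-1 critical points, `MorseGscIsRLinkSphere` turns it into an ℝ-link-sphere structure `IsRLinkSphere M L`, and
`GscCP2Cancellation` is exactly `CP2CancellationOne` restricted to ℝ-link spheres.  Text = lens-4 GEN 9 `split/GlueProofY.lean`
(`cp2CancellationOneGscGlue_holds`), re-based on the born route file. -/

set_option linter.dupNamespace false

namespace Summit.SmoothPoincare4.SmoothPoincare4.Theorems.RootDecompYCP2CancellationOneGscSplit

open scoped Manifold ContDiff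
open Summit.SmoothPoincare4.SmoothPoincare4.Theses.RootDecompY

/-- The split glue of route Y at `CP2CancellationOne` holds outright. -/
theorem cp2CancellationOneGscGlue_holds : CP2CancellationOneGscGlue := by
  intro hN hW hU M _ _ _ _ _ e hd
  haveI : CompactSpace M := Literature.Topology.FourManifolds.compactSpace_of_homotopyEquiv_sphere_four_holds M e
  obtain ⟨o⟩ := Literature.Topology.FourManifolds.isOrientable_of_homotopyEquiv_sphere_four_holds M e
  obtain ⟨n, L, hM⟩ := hW ⟨M, o, ⟨e⟩⟩ (hN ⟨M, o, ⟨e⟩⟩)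
  exact hU n L M hM hd

end Summit.SmoothPoincare4.SmoothPoincare4.Theorems.RootDecompYCP2CancellationOneGscSplit
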